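import Literature.AlgebraicGeometry.Frobenioids.Composites
import Mathlib.CategoryTheory.Comma.Over.Basic
import Mathlib.CategoryTheory.IsomorphismClasses
import Mathlib.Data.Nat.PrimeFin
import Mathlib.Data.Set.Finite.Basic
import HarnessLib

/-!
# Frobenioids I, Proposition 1.10 (Morphisms of Frobenius Type), parts (iv), (v)

Mochizuki, *The geometry of Frobenioids I: the general theory*, Kyushu J. Math. **62** (2008)
293–400, §1, Proposition 1.10 (iv), (v) and their proof, kurims text pp. 34–36
[cite: MochizukiFrdI2008, Prop. 1.10]. Standing data: `C → F_Φ` a Frobenioid (`hF`).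

> "(iv) A morphism of Frobenius type with isotropic domain is a prime-Frobenius morphism if and
> only if it is irreducible [cf. §0]. In particular, if `A ∈ Ob(C)` is isotropic, then there exist
> infinitely many isomorphism classes of objects of `^A C` that arise from irreducible arrows with
> domain `A`.
> (v) A morphism of `C` is a morphism of Frobenius type if and only if it is a composite of
> prime-Frobenius morphisms."

PROVED ("(iv) follows immediately from Proposition 1.7, (v), and the well-known structure of
the multiplicative monoid `N_{≥1}` [cf. also Definition 1.3, (ii)]"; "(v) follows immediately
from Proposition 1.7, (i); Definition 1.3, (ii)", p. 36).

Renderings (recorded for the referee). (iv), second sentence: the set of isomorphism classes of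
objects of `^A C = Under A` arising from irreducible arrows is `Set.Infinite` — literally the
negation of "`A` is an anchor" (§0 p. 18, `IsAnchor`). (v): "a composite of prime-Frobenius
morphisms" is the inductive predicate `IsPrimeFrobeniusComposite` generated by composition with
prime-Frobenius morphisms starting from ISOMORPHISMS — the empty composite must be read as an
arbitrary isomorphism, since the morphisms of Frobenius type of degree `1` are exactly the
isomorphisms (Prop. 1.4 (iii)); with the empty composite read as an identity only, (v) would fail
for non-identity isomorphisms. No statement of the paper is otherwise strengthened or weakened.
-/

namespace Literature.AlgebraicGeometry.Frobenioids

open CategoryTheory Opposite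

universe w v v' u u'

namespace PreFrobenioid

variable {D : Type u} [Category.{v} D] {Φ : Dᵒᵖ ⥤ CommMonCat.{w}}
  {C : Type u'} [Category.{v'} C] {F : C ⥤ ElemFrobenioid Φ}

/-! ### Morphisms of Frobenius type of degree one; splitting off degrees -/

/-- A morphism of Frobenius type of Frobenius degree `1` is an isomorphism (it is an LB-invertible
pre-step, Prop. 1.4 (iii)). [cite: MochizukiFrdI2008, Prop. 1.10(iv) p.36] -/
theorem isIso_of_isFrobeniusType_of_degFr_eq_one (hF : IsFrobenioid F) {A B : C} {φ : A ⟶ B}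
    (hφ : IsFrobeniusType F φ) (hd : degFr F φ = 1) : IsIso φ :=
  isIso_of_isLBInvertible_of_isPreStep F hF φ hφ.1 ⟨hd, hφ.2⟩

/-- An isomorphism is not a prime-Frobenius morphism (its degree is `1`).
[cite: MochizukiFrdI2008, Prop. 1.10(iv) p.36] -/
theorem not_isPrimeFrobenius_of_isIso {A B : C} (φ : A ⟶ B) [IsIso φ] : ¬ IsPrimeFrobenius F φ := by
  rintro ⟨-, hp⟩
  rw [isLinear_of_isIso F φ, PNat.one_coe] at hp
  exact Nat.not_prime_one hp

/-- Splitting a morphism of Frobenius type of degree `a · b` as (degree `a`) then (degree `b`)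
(Def. 1.3 (ii): existence and essential uniqueness). [cite: MochizukiFrdI2008, Prop. 1.10(v) p.36] -/
theorem exists_split_of_isFrobeniusType (hF : IsFrobenioid F) {A B : C} {φ : A ⟶ B}
    (hφ : IsFrobeniusType F φ) (a b : ℕ+) (hab : degFr F φ = a * b) :
    ∃ (X : C) (μ : A ⟶ X) (ν : X ⟶ B), μ ≫ ν = φ ∧ IsFrobeniusType F μ ∧ degFr F μ = a ∧
      IsFrobeniusType F ν ∧ degFr F ν = b := by
  have hP := hF.isPreFrobenioid
  obtain ⟨X, μ, hμ, hμd⟩ := hF.ii_exists A a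
  obtain ⟨Y, ν, hν, hνd⟩ := hF.ii_exists X b
  obtain ⟨i, hi⟩ := hF.ii_unique (μ ≫ ν) φ (IsFrobeniusType.comp F hF hμ hν) hφ
    (by rw [degFr_comp, hμd, hνd, hab])
  refine ⟨X, μ, ν ≫ i.hom, by rw [← Category.assoc, hi], hμ, hμd,
    IsFrobeniusType.comp F hF hν (isFrobeniusType_of_isIso F hP i.hom), ?_⟩
  rw [degFr_comp, hνd, isLinear_of_isIso F i.hom, mul_one]

/-! ### Proposition 1.10 (iv) -/

/-- **Prop. 1.10 (iv)**, necessity: a prime-Frobenius morphism with isotropic domain is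
irreducible (in a factorisation both factors are of Frobenius type by Prop. 1.7 (v), their degrees
multiply to a prime, and a degree-one factor is an isomorphism).
[cite: MochizukiFrdI2008, Prop. 1.10(iv) p.34] -/
theorem IsPrimeFrobenius.isIrreducibleHom (hF : IsFrobenioid F) {A B : C} {φ : A ⟶ B}
    (hφ : IsPrimeFrobenius F φ) (hA : IsIsotropic F A) : IsIrreducibleHom φ := by
  refine ⟨fun h => not_isPrimeFrobenius_of_isIso (F := F) φ hφ, fun X β α hfac => ?_⟩
  have h : IsFrobeniusType F (β ≫ α) := by rw [hfac]; exact hφ.1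
  obtain ⟨hα, hβ⟩ := isFrobeniusType_factors F hF h hA
  have hdeg : (degFr F β : ℕ) * degFr F α = degFr F φ := by
    rw [← PNat.mul_coe, ← degFr_comp, hfac]
  rcases (Nat.prime_def.mp hφ.2).2 (degFr F β : ℕ) ⟨_, hdeg.symm⟩ with h1 | h2
  · exact Or.inr (isIso_of_isFrobeniusType_of_degFr_eq_one hF hβ (PNat.coe_inj.mp h1))
  · refine Or.inl (isIso_of_isFrobeniusType_of_degFr_eq_one hF hα (PNat.coe_inj.mp ?_))
    have hpos : 0 < (degFr F φ : ℕ) := PNat.pos _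
    rw [h2] at hdeg
    rw [PNat.one_coe]
    exact (Nat.mul_right_inj hpos.ne').mp (by simpa using hdeg)

/-- **Prop. 1.10 (iv)**, sufficiency: an irreducible morphism of Frobenius type is a
prime-Frobenius morphism (split off any proper factorisation of the degree via Def. 1.3 (ii)).
[cite: MochizukiFrdI2008, Prop. 1.10(iv) p.34] -/
theorem isPrimeFrobenius_of_isIrreducibleHom (hF : IsFrobenioid F) {A B : C} {φ : A ⟶ B}
    (hφ : IsFrobeniusType F φ) (hirr : IsIrreducibleHom φ) : IsPrimeFrobenius F φ := by
  refine ⟨hφ, Nat.prime_def.mpr ⟨?_, fun m hm => ?_⟩⟩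
  · -- degree `≠ 1`, since `φ` is not an isomorphism
    by_contra h
    have h1 : degFr F φ = 1 := PNat.eq (by have := (degFr F φ).pos; rw [PNat.one_coe]; omega)
    exact hirr.1 (isIso_of_isFrobeniusType_of_degFr_eq_one hF hφ h1)
  · obtain ⟨k, hk⟩ := hm
    have hmpos : 0 < m := Nat.pos_of_ne_zero (by rintro rfl; simp at hk)
    have hkpos : 0 < k := Nat.pos_of_ne_zero (by rintro rfl; simp at hk)
    obtain ⟨X, μ, ν, hfac, hμ, hμd, hν, hνd⟩ :=
      exists_split_of_isFrobeniusType hF hφ ⟨m, hmpos⟩ ⟨k, hkpos⟩ (PNat.eq (by simpa using hk))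
    rcases hirr.2 μ ν hfac with hνi | hμi
    · right
      haveI := hνi
      have : degFr F ν = 1 := isLinear_of_isIso F ν
      rw [hνd] at this
      have hk1 : k = 1 := by simpa using congrArg (fun x : ℕ+ => (x : ℕ)) this
      rw [hk, hk1, mul_one]
    · left
      haveI := hμi
      have : degFr F μ = 1 := isLinear_of_isIso F μ
      rw [hμd] at this
      simpa using congrArg (fun x : ℕ+ => (x : ℕ)) this

/-- **Prop. 1.10 (iv)**: "A morphism of Frobenius type with isotropic domain is a prime-Frobenius
morphism if and only if it is irreducible." [cite: MochizukiFrdI2008, Prop. 1.10(iv) p.34] -/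
theorem isPrimeFrobenius_iff_isIrreducibleHom (hF : IsFrobenioid F) {A B : C} {φ : A ⟶ B}
    (hφ : IsFrobeniusType F φ) (hA : IsIsotropic F A) : IsPrimeFrobenius F φ ↔ IsIrreducibleHom φ :=
  ⟨fun h => h.isIrreducibleHom hF hA, fun h => isPrimeFrobenius_of_isIrreducibleHom hF hφ h⟩

/-- **Prop. 1.10 (iv)**, "In particular": if `A` is isotropic there are infinitely many
isomorphism classes of objects of `^A C` arising from irreducible arrows with domain `A` (one for
each prime `p`: a morphism of Frobenius type of degree `p`, Def. 1.3 (ii); distinct primes give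
non-isomorphic objects of `^A C` by Remark 1.1.1) — i.e. an isotropic object is never an anchor
(§0). [cite: MochizukiFrdI2008, Prop. 1.10(iv) p.34] -/
theorem infinite_isoClasses_irreducible_under (hF : IsFrobenioid F) {A : C} (hA : IsIsotropic F A) :
    Set.Infinite {x : Quotient (isIsomorphicSetoid (Under A)) |
      ∃ f : Under A, IsIrreducibleHom f.hom ∧ Quotient.mk _ f = x} := by
  -- for each prime `p` choose a morphism of Frobenius type of degree `p` out of `A`
  have hex : ∀ p : ℕ+, ∃ (B : C) (φ : A ⟶ B), IsFrobeniusType F φ ∧ degFr F φ = p :=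
    fun p => hF.ii_exists A p
  choose B φ hφ hφd using hex
  let f : ℕ → Quotient (isIsomorphicSetoid (Under A)) :=
    fun n => Quotient.mk _ (Under.mk (φ (Nat.toPNat' n)))
  refine Set.infinite_of_injOn_mapsTo (f := f) (s := {p : ℕ | p.Prime}) ?_ ?_ Nat.infinite_setOf_prime
  · -- injective on primes: an isomorphism under `A` preserves the Frobenius degree
    intro p hp q hq hpq
    obtain ⟨e⟩ := Quotient.exact hpq
    let i : B (Nat.toPNat' p) ≅ B (Nat.toPNat' q) := (Under.forget A).mapIso e
    have hw : φ (Nat.toPNat' p) ≫ i.hom = φ (Nat.toPNat' q) := Under.w e.hom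
    have hd := congrArg (degFr F) hw
    rw [degFr_comp, isLinear_of_isIso F i.hom, mul_one, hφd, hφd] at hd
    have := congrArg (fun x : ℕ+ => (x : ℕ)) hd
    simpa [Nat.toPNat'_coe, hp.pos, hq.pos] using this
  · intro p hp
    refine ⟨Under.mk (φ (Nat.toPNat' p)), ?_, rfl⟩
    have hprime : IsPrimeFrobenius F (φ (Nat.toPNat' p)) := by
      refine ⟨hφ _, ?_⟩
      rw [hφd, Nat.toPNat'_coe, if_pos hp.pos]
      exact hp
    exact hprime.isIrreducibleHom hF hA

/-- **Prop. 1.10 (iv)**, restated with §0's vocabulary: an isotropic object of a Frobenioid is not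
an anchor. [cite: MochizukiFrdI2008, Prop. 1.10(iv) p.34] -/
theorem not_isAnchor_of_isIsotropic (hF : IsFrobenioid F) {A : C} (hA : IsIsotropic F A) :
    ¬ IsAnchor A :=
  infinite_isoClasses_irreducible_under hF hA

/-! ### Proposition 1.10 (v) -/

/-- "A composite of prime-Frobenius morphisms" (FrdI Prop. 1.10 (v)), as an inductive predicate:
isomorphisms (the empty composite — see the module docstring) and composites `χ ∘ ψ` of such a
composite `χ` with a prime-Frobenius morphism `ψ`. [cite: MochizukiFrdI2008, Prop. 1.10(v) p.35] -/
inductive IsPrimeFrobeniusComposite (F : C ⥤ ElemFrobenioid Φ) : ∀ {A B : C}, (A ⟶ B) → Prop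
  /-- an isomorphism is an (empty) composite of prime-Frobenius morphisms -/
  | of_isIso {A B : C} (φ : A ⟶ B) [IsIso φ] : IsPrimeFrobeniusComposite F φ
  /-- prepending a prime-Frobenius morphism -/
  | comp {A X B : C} (ψ : A ⟶ X) (χ : X ⟶ B) :
      IsPrimeFrobenius F ψ → IsPrimeFrobeniusComposite F χ → IsPrimeFrobeniusComposite F (ψ ≫ χ)

/-- **Prop. 1.10 (v)**, sufficiency: a composite of prime-Frobenius morphisms is of Frobenius
type (Prop. 1.7 (i)). [cite: MochizukiFrdI2008, Prop. 1.10(v) p.35] -/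
theorem IsPrimeFrobeniusComposite.isFrobeniusType (hF : IsFrobenioid F) {A B : C} {φ : A ⟶ B}
    (h : IsPrimeFrobeniusComposite F φ) : IsFrobeniusType F φ := by
  induction h with
  | of_isIso φ => exact isFrobeniusType_of_isIso F hF.isPreFrobenioid φ
  | comp ψ χ hψ _ ih => exact IsFrobeniusType.comp F hF hψ.1 ih

/-- **Prop. 1.10 (v)**, necessity: a morphism of Frobenius type is a composite of prime-Frobenius
morphisms (induction on the degree: split off a prime factor via Def. 1.3 (ii); degree `1` means
isomorphism). [cite: MochizukiFrdI2008, Prop. 1.10(v) p.35] -/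
theorem IsFrobeniusType.isPrimeFrobeniusComposite (hF : IsFrobenioid F) {A B : C} {φ : A ⟶ B}
    (hφ : IsFrobeniusType F φ) : IsPrimeFrobeniusComposite F φ := by
  -- strong induction on the Frobenius degree
  suffices h : ∀ (n : ℕ) {A B : C} (φ : A ⟶ B), IsFrobeniusType F φ → (degFr F φ : ℕ) = n →
      IsPrimeFrobeniusComposite F φ from h _ φ hφ rfl
  intro n
  induction n using Nat.strong_induction_on with
  | _ n ih =>
    intro A B φ hφ hn
    by_cases h1 : n = 1
    · subst h1
      haveI := isIso_of_isFrobeniusType_of_degFr_eq_one hF hφ (PNat.eq (by rw [hn, PNat.one_coe]))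
      exact IsPrimeFrobeniusComposite.of_isIso φ
    · obtain ⟨p, hp, k, hk⟩ := Nat.exists_prime_and_dvd h1
      have hnpos : 0 < n := by rw [← hn]; exact PNat.pos _
      have hkpos : 0 < k := Nat.pos_of_ne_zero (by rintro rfl; simp [hk] at hnpos)
      obtain ⟨X, μ, ν, hfac, hμ, hμd, hν, hνd⟩ := exists_split_of_isFrobeniusType hF hφ
        ⟨p, hp.pos⟩ ⟨k, hkpos⟩ (PNat.eq (by simp [hn, hk]))
      rw [← hfac]
      refine IsPrimeFrobeniusComposite.comp μ ν ⟨hμ, by rw [hμd]; exact hp⟩ (ih k ?_ ν hν ?_)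
      · rw [hk]
        exact lt_mul_left hkpos hp.one_lt
      · rw [hνd]; rfl

/-- **Prop. 1.10 (v)**: "A morphism of `C` is a morphism of Frobenius type if and only if it is a
composite of prime-Frobenius morphisms." [cite: MochizukiFrdI2008, Prop. 1.10(v) p.35] -/
theorem isFrobeniusType_iff_isPrimeFrobeniusComposite (hF : IsFrobenioid F) {A B : C} (φ : A ⟶ B) :
    IsFrobeniusType F φ ↔ IsPrimeFrobeniusComposite F φ :=
  ⟨fun h => h.isPrimeFrobeniusComposite hF, fun h => h.isFrobeniusType hF⟩

end PreFrobenioid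

end Literature.AlgebraicGeometry.Frobenioids
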